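import Summits.QuantumFields.BalabanUV.Beta.D1BFx.LandauDictionaryGamma
import Summits.QuantumFields.BalabanUV.Beta.D1BFx.BoundedSuperposition
import Literature.MathematicalPhysics.QuantumFieldTheory.Balaban1983to89.Beta.ResolventReflection

/-!
# Road BF-x, slot (K) dictionary brick B7 (DICT-Γ), part 2: THE READ-OUT BY UNIQUENESS —
# `Γ(·,(l,x′)) = c⁻¹·(Ga δ_{(l,x′)} − (c∕r)·d𝔅δ δ_{(l,x′)} − H𝒬(Ga δ_{(l,x′)}))` from X₁a ALONE

HONEST DEPENDENCY (page 1, mandatory): continuum YM on T⁴ ⇐ BetaPertH ∧ nine spine estimates (0/9 proved); BetaPertH ⇐ (D1) ∧ (D4) ∧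
CAP+tail; G-an2-4 gates asym, D1 and NE2/3/4.  HONEST FRAMING (cell contract, verbatim): «discharging `BetaPertH` makes Bałaban's UV
stability UNCONDITIONAL — a real constructive-QFT result; it is NOT the continuum limit and NOT the Clay problem.»  THIS MODULE is [folklore]
assembly BY NAME over part 1 (`LandauDictionaryGamma.solvesKKT_force_w`), the road owner d1-p2's `BoundedSuperposition.solvesKKT_Hop_bdd`
(the typed minimiser superposition `H b` kills bounded block averages `b`), an2's `KKTFluctuationUnique.eq_Gam_of_solvesKKT` and
`ResolventReflection.solvesKKT_smul`∕`tempered1_smul`; no `def`, no `def … : Prop`, nothing cited, 0 sorry.  X₁a is a DISPLAYED HYPOTHESIS (the owner's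
`X1-SPEC.md`); NOTHING says it holds.  0∕4 binders of row D1 (hW, hR, D1Tel, D1Rep) discharged; NOT D1, NOT BetaPertH, NOT continuum, NOT Clay.

ABSOLUTE RULE (cell charter, verbatim): «No internally-minted statement may enter as a cited fact. Every hypothesis is either kernel-proved
in this package or a verbatim quotation of a PUBLISHED theorem with page reference. The manuscript(s) under audit are NOT citable for their
own disputed steps — they are the thing under adjudication; programme-internal (2001/route/tribunal) claims are never citable.»

THE LINE (K-R1-SPEC v2 §2 (D-Γ); `DICT-BRICKS.md` row B7).  Part 1: the force `c•δ_{(l,x′)}` drives `A := Ga δ − (c∕r)•dχ` with block averages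
`b := 𝒬(Ga δ)`.  The owner's `H b := Hop b` solves the force-free system with the same block averages.  `SolvesKKT` is ℝ-linear (§1), so
`c⁻¹•(A − H b)` solves the system with force `δ_{(l,x′)}` and ZERO block averages, is tempered, hence IS the typed column `Γ(·,(l,x′))`
(`eq_Gam_of_solvesKKT`), with its two multipliers read off alongside.  This is (D-Γ) with its TRUE coefficients: the `c⁻¹` in front, the
`r⁻¹` on the pure-gauge bi-Laplacian term, and `Γ_R := Ga − H𝒬Ga` realised by the typed `Hop` (which B6 identifies with `HRcol` under X₁).

CONTENT. §1 `solvesKKT_sub`, tempered algebra (`tempered1_sub`, `tempered0_sub`; scaling is an2's `ResolventReflection.tempered*_smul`),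
`abs_contourSum_le`;
§2 the unit force: `abs_delta1_le`, `codiff₁_delta1_eq_zero` (support `{x′, x′+e_l}`); §3 **`gam_eq_of_force_w`**.
Unit `b2b-balaban-beta-d1-formalise-leaf-06` (gen 6), 2026-08-20; CLAIM «DICT-B7» (journal).
-/

namespace Summit.QuantumFields.BalabanUV.Beta.D1BFx.LandauDictionaryGammaReadout

open Finset
open scoped BigOperators
open Literature.MathematicalPhysics.QuantumFieldTheory.Balaban1983to89
open Literature.MathematicalPhysics.QuantumFieldTheory.Balaban1983to89.Beta
open ExpKernelCalculus (Site MKer Decays Zl)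
open B12Sec2to5 (l1 l1_nonneg)
open AffineAveraging (Form0 Form1 box toSite unitVec dz curv curvAdj codiff₁ blockSum contourSum)
open AffineReproduction (contourSumAdj IsBlockConst contourSum_sub)
open KKTFluctuationKernel (delta1 delta1_apply Gam GamΦ GamM)
open KKTFluctuationUnique (SolvesKKT Tempered0 Tempered1 eq_Gam_of_solvesKKT)
open KernelSpecInstance (Hop Φop Mop opEL opG opM opΦ)
open ResolventReflection (solvesKKT_smul solvesKKT_congr tempered1_smul tempered0_smul)
open BiLaplaceBlockKKT (Sb)
open KernelFormOperators (kerOp₁ Rf abs_kerOp₁_le)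
open TowerEquationForms (Gf)
open BoundedSuperposition (solvesKKT_Hop_bdd tempered_Hop_bdd tempered_Φop_bdd tempered_Mop_bdd)
open LandauDictionaryGamma (solvesKKT_force_w tempered_force_w)

noncomputable section

/-! ## §1 Linearity of the typed KKT system and of temperedness -/

section Linear

variable {d N : ℕ}

/-- [folklore] The KKT system is linear: the difference of two solutions solves the system with the differences of the data. -/
theorem solvesKKT_sub {F₁ c₁ A₁ φ₁ F₂ c₂ A₂ φ₂ : Form1 (d + 1) ℝ} {μ₁ μ₂ : Form0 (d + 1) ℝ}
    (h₁ : SolvesKKT N F₁ c₁ A₁ φ₁ μ₁) (h₂ : SolvesKKT N F₂ c₂ A₂ φ₂ μ₂) :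
    SolvesKKT N (F₁ - F₂) (c₁ - c₂) (A₁ - A₂) (φ₁ - φ₂) (μ₁ - μ₂) where
  el κ x := by
    have e1 : curvAdj (curv (A₁ - A₂)) = curvAdj (curv A₁) - curvAdj (curv A₂) := map_sub opEL A₁ A₂
    have e2 : contourSumAdj N (φ₁ - φ₂) = contourSumAdj N φ₁ - contourSumAdj N φ₂ := map_sub (opΦ N) φ₁ φ₂
    have e3 : dz (codiff₁ (dz (μ₁ - μ₂))) = dz (codiff₁ (dz μ₁)) - dz (codiff₁ (dz μ₂)) := map_sub opM μ₁ μ₂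
    rw [e1, e2, e3]
    simp only [Pi.sub_apply]
    rw [h₁.el, h₂.el]
    ring
  gauge y b hb := by
    have e : codiff₁ (dz (codiff₁ (A₁ - A₂))) = codiff₁ (dz (codiff₁ A₁)) - codiff₁ (dz (codiff₁ A₂)) := map_sub opG A₁ A₂
    rw [e]
    simp only [Pi.sub_apply]
    rw [h₁.gauge y b hb, h₂.gauge y b hb]
  mean y := by
    have e : blockSum N (μ₁ - μ₂) y = blockSum N μ₁ y - blockSum N μ₂ y := by
      simp only [AffineAveraging.blockSum, Pi.sub_apply, Finset.sum_sub_distrib]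
    rw [e, h₁.mean, h₂.mean, sub_zero]
  avg κ y := by
    rw [contourSum_sub]
    simp only [Pi.sub_apply]
    rw [h₁.avg, h₂.avg]

/-- [folklore] `(1 + |x|₁)^m ≤ (1 + |x|₁)^(m + k)`. -/
theorem one_add_l1_pow_mono (x : Site (d + 1)) (m k : ℕ) : (1 + l1 x) ^ m ≤ (1 + l1 x) ^ (m + k) :=
  pow_le_pow_right₀ (by linarith [l1_nonneg x]) (Nat.le_add_right m k)

/-- [folklore] Tempered 1-forms are closed under subtraction. -/
theorem tempered1_sub {A B : Form1 (d + 1) ℝ} (hA : Tempered1 A) (hB : Tempered1 B) : Tempered1 (A - B) := by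
  obtain ⟨CA, mA, hA⟩ := hA
  obtain ⟨CB, mB, hB⟩ := hB
  refine ⟨|CA| + |CB|, mA + mB, fun κ x => ?_⟩
  have h0 : 0 ≤ 1 + l1 x := by linarith [l1_nonneg x]
  have hA' : |A κ x| ≤ |CA| * (1 + l1 x) ^ (mA + mB) :=
    (hA κ x).trans ((mul_le_mul_of_nonneg_right (le_abs_self CA) (pow_nonneg h0 _)).trans
      (mul_le_mul_of_nonneg_left (one_add_l1_pow_mono x mA mB) (abs_nonneg CA)))
  have hB' : |B κ x| ≤ |CB| * (1 + l1 x) ^ (mA + mB) :=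
    (hB κ x).trans ((mul_le_mul_of_nonneg_right (le_abs_self CB) (pow_nonneg h0 _)).trans
      (mul_le_mul_of_nonneg_left (by rw [add_comm mA]; exact one_add_l1_pow_mono x mB mA) (abs_nonneg CB)))
  rw [Pi.sub_apply, Pi.sub_apply]
  calc |A κ x - B κ x| ≤ |A κ x| + |B κ x| := abs_sub _ _
    _ ≤ (|CA| + |CB|) * (1 + l1 x) ^ (mA + mB) := by rw [add_mul]; exact add_le_add hA' hB'

/-- [folklore] Tempered 0-forms are closed under subtraction. -/
theorem tempered0_sub {f g : Form0 (d + 1) ℝ} (hf : Tempered0 f) (hg : Tempered0 g) : Tempered0 (f - g) := by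
  obtain ⟨Cf, mf, hf⟩ := hf
  obtain ⟨Cg, mg, hg⟩ := hg
  refine ⟨|Cf| + |Cg|, mf + mg, fun x => ?_⟩
  have h0 : 0 ≤ 1 + l1 x := by linarith [l1_nonneg x]
  have hf' : |f x| ≤ |Cf| * (1 + l1 x) ^ (mf + mg) :=
    (hf x).trans ((mul_le_mul_of_nonneg_right (le_abs_self Cf) (pow_nonneg h0 _)).trans
      (mul_le_mul_of_nonneg_left (one_add_l1_pow_mono x mf mg) (abs_nonneg Cf)))
  have hg' : |g x| ≤ |Cg| * (1 + l1 x) ^ (mf + mg) :=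
    (hg x).trans ((mul_le_mul_of_nonneg_right (le_abs_self Cg) (pow_nonneg h0 _)).trans
      (mul_le_mul_of_nonneg_left (by rw [add_comm mf]; exact one_add_l1_pow_mono x mg mf) (abs_nonneg Cg)))
  rw [Pi.sub_apply]
  calc |f x - g x| ≤ |f x| + |g x| := abs_sub _ _
    _ ≤ (|Cf| + |Cg|) * (1 + l1 x) ^ (mf + mg) := by rw [add_mul]; exact add_le_add hf' hg'

/-- [folklore] Block averages of a bounded 1-form are bounded: `|𝒬_N A κ y| ≤ (N^d·… ) · B`, here `|box|·N·B`. -/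
theorem abs_contourSum_le {A : Form1 (d + 1) ℝ} {B : ℝ} (h : ∀ κ x, |A κ x| ≤ B) (κ : Fin (d + 1)) (y : Site (d + 1)) :
    |contourSum N A κ y| ≤ ((box (d + 1) N).card * N) * B := by
  simp only [AffineAveraging.contourSum]
  calc |∑ bb ∈ box (d + 1) N, ∑ s ∈ Finset.range N, A κ ((N : ℤ) • y + toSite bb + (s : ℤ) • unitVec κ)|
      ≤ ∑ bb ∈ box (d + 1) N, ∑ s ∈ Finset.range N, |A κ ((N : ℤ) • y + toSite bb + (s : ℤ) • unitVec κ)| :=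
        (Finset.abs_sum_le_sum_abs _ _).trans (Finset.sum_le_sum fun bb _ => Finset.abs_sum_le_sum_abs _ _)
    _ ≤ ∑ bb ∈ box (d + 1) N, ∑ _s ∈ Finset.range N, B := Finset.sum_le_sum fun bb _ => Finset.sum_le_sum fun s _ => h _ _
    _ = ((box (d + 1) N).card * N) * B := by
        rw [Finset.sum_const, Finset.sum_const, Finset.card_range, nsmul_eq_mul, nsmul_eq_mul]; ring

end Linear

/-! ## §2 The unit force `δ_{(l,x′)}`: bounded by `1`, codifferential supported in `{x′, x′ + e_l}` -/

section Delta

/-- [folklore] `|δ_{(l,x′)}| ≤ 1`. -/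
theorem abs_delta1_le (l : Fin 4) (x' : Site 4) (κ : Fin 4) (x : Site 4) : |delta1 l x' κ x| ≤ 1 := by
  rw [delta1_apply]
  split_ifs <;> simp

/-- [folklore] `δ(δ_{(l,x′)})` vanishes off `{x′, x′ + e_l}`. -/
theorem codiff₁_delta1_eq_zero (l : Fin 4) (x' : Site 4) {x : Site 4} (hx : x ∉ ({x', x' + unitVec l} : Finset (Site 4))) :
    codiff₁ (delta1 l x') x = 0 := by
  simp only [AffineAveraging.codiff₁, delta1_apply]
  refine Finset.sum_eq_zero fun κ _ => ?_
  have h1 : ¬(κ = l ∧ x - unitVec κ = x') := by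
    rintro ⟨rfl, h⟩
    exact hx (Finset.mem_insert.2 (Or.inr (Finset.mem_singleton.2 (by rw [← h, sub_add_cancel]))))
  have h2 : ¬(κ = l ∧ x = x') := by
    rintro ⟨-, rfl⟩
    exact hx (Finset.mem_insert_self _ _)
  rw [if_neg h1, if_neg h2, sub_zero]

end Delta

/-! ## §3 BRICK B7: the dictionary line (D-Γ) by uniqueness -/

section Readout

variable (n : ℕ) [NeZero n] (a : ℝ) {r a' c : ℝ} {Ga : MKer 4 (Fin 4)} {C δ : ℝ}

/-- [folklore] **BRICK B7 — THE DICTIONARY LINE (D-Γ) FROM X₁a ALONE.**  For a decaying vector kernel `Ga` whose columns satisfy the weighted X₁a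
with `r ≠ 0`, `c ≠ 0`, and every source bond `(l, x′)`: with `A₁ := Ga δ_{(l,x′)}` (`= kerOp₁ Ga (delta1 l x′)`), `b := 𝒬_n A₁`,
`χ := Σ_{z ∈ {x′, x′+e_l}} (δ δ_{(l,x′)})(z)·Sb(·,z)` (the bi-Laplacian block kernel acting on `δ δ_{(l,x′)}`):
`Γ(·,(l,x′)) = c⁻¹ • (A₁ − (c∕r)•dχ − H b)`, `Γ^Φ(·,(l,x′)) = c⁻¹ • (−a′•b − Φ b)`, `Γ^M(·,(l,x′)) = c⁻¹ • (−(r n²)•G′R(δA₁) − M b)`,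
where `(H, Φ, M) = (Hop, Φop, Mop)` is the typed minimiser superposition of `Beta/KernelSpecInstance`. -/
theorem gam_eq_of_force_w (ha : 0 < a) (hr : r ≠ 0) (hc : c ≠ 0) (hGa : Decays Ga C δ) (hδ : 0 < δ)
    (hX1a : ∀ (m : Fin 4) (z : Site 4) (κ : Fin 4) (x : Site 4),
      curvAdj (curv (fun κ' p => Ga p z κ' m)) κ x = c * delta1 m z κ x - r * dz (Rf n a (codiff₁ (fun κ' p => Ga p z κ' m))) κ x
        - a' * contourSumAdj n (contourSum n (fun κ' p => Ga p z κ' m)) κ x)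
    (l : Fin 4) (x' : Site 4) :
    (fun κ x => Gam (N := n) κ x l x')
        = c⁻¹ • (kerOp₁ Ga (delta1 l x')
            - (c / r) • dz (fun p => ∑ z ∈ ({x', x' + unitVec l} : Finset (Site 4)), codiff₁ (delta1 l x') z * Sb (N := n) p z)
            - Hop (N := n) (contourSum n (kerOp₁ Ga (delta1 l x'))))
      ∧ (fun κ q => GamΦ (N := n) κ q l x')
        = c⁻¹ • ((fun κ y => -(a' * contourSum n (kerOp₁ Ga (delta1 l x')) κ y)) - Φop (N := n) (contourSum n (kerOp₁ Ga (delta1 l x'))))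
      ∧ (fun z => GamM (N := n) z l x')
        = c⁻¹ • ((fun p => -(r * (n : ℝ) ^ 2) * Gf n a (Rf n a (codiff₁ (kerOp₁ Ga (delta1 l x')))) p)
            - Mop (N := n) (contourSum n (kerOp₁ Ga (delta1 l x')))) := by
  set S : Finset (Site 4) := {x', x' + unitVec l} with hSdef
  have hv : ∀ κ x, |delta1 l x' κ x| ≤ 1 := abs_delta1_le l x'
  have hS : ∀ x ∉ S, codiff₁ (delta1 l x') x = 0 := fun x hx => codiff₁_delta1_eq_zero l x' hx
  -- part 1: the force-driven solution with block averages `b`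
  have h1 := solvesKKT_force_w n a (r := r) (a' := a') (c := c) ha hr hGa hδ hv S hS hX1a
  obtain ⟨t1A, t1φ, t1μ⟩ := tempered_force_w n a (r := r) (a' := a') (c := c) ha hGa hδ hv S
  -- the owner's typed superposition killing the block averages `b`
  set b : Form1 4 ℝ := contourSum n (kerOp₁ Ga (delta1 l x')) with hbdef
  have hA₁ : ∀ κ x, |kerOp₁ Ga (delta1 l x') κ x| ≤ 4 * C * Zl 4 δ * 1 := fun κ x => abs_kerOp₁_le hGa hδ hv κ x
  have hb : ∀ κ y, |b κ y| ≤ ((box (3 + 1) n).card * n) * (4 * C * Zl 4 δ * 1) := fun κ y => abs_contourSum_le hA₁ κ y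
  have h2 := solvesKKT_Hop_bdd (N := n) hb
  -- difference, rescaled by `c⁻¹`: force `δ_{(l,x′)}`, zero block averages
  have h3 := solvesKKT_smul c⁻¹ (solvesKKT_sub h1 h2)
  have h4 : SolvesKKT n (delta1 l x') 0
      (c⁻¹ • ((kerOp₁ Ga (delta1 l x') - (c / r) • dz (fun p => ∑ z ∈ S, codiff₁ (delta1 l x') z * Sb (N := n) p z)) - Hop (N := n) b))
      (c⁻¹ • ((fun κ y => -(a' * contourSum n (kerOp₁ Ga (delta1 l x')) κ y)) - Φop (N := n) b))
      (c⁻¹ • ((fun p => -(r * (n : ℝ) ^ 2) * Gf n a (Rf n a (codiff₁ (kerOp₁ Ga (delta1 l x')))) p) - Mop (N := n) b)) :=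
    solvesKKT_congr (by rw [sub_zero, smul_smul, inv_mul_cancel₀ hc, one_smul]) (by rw [sub_self, smul_zero]) h3
  have hu := eq_Gam_of_solvesKKT h4 (tempered1_smul _ (tempered1_sub t1A (tempered_Hop_bdd hb)))
    (tempered1_smul _ (tempered1_sub t1φ (tempered_Φop_bdd hb))) (tempered0_smul _ (tempered0_sub t1μ (tempered_Mop_bdd hb)))
  exact ⟨hu.1.symm, hu.2.1.symm, hu.2.2.symm⟩

end Readout

end

end Summit.QuantumFields.BalabanUV.Beta.D1BFx.LandauDictionaryGammaReadout
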